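import Mathlib
import Summits.AtomisticToContinuum.Crystallization.Theses.PhononSlackCertificates
import Summits.AtomisticToContinuum.Crystallization.Theorems.PhononSlackCertificatesNearFarGlueRLoose
import Summits.AtomisticToContinuum.Crystallization.Theorems.PhononSlackCertificatesCoerciveTwoShellGapSepReduction
import Literature.MathematicalPhysics.StatisticalMechanics.LennardJonesClusters

/-!
# Crux `PhononSlackCertificates.NearFarGlueR` (stmt-AtomisticToContinuum-14970), line `Sketch`:
loose exhaustion — stripping a configuration down to its NET-BOUND core

Continuation lead c3; part 3a of the loose-particle species.  With the half-repulsion site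
functional `A_j(x) = Σ_{k≠j} (min(V,0) + ½·max(V,0))(|x_j − x_k|)` of part 1
(`PhononSlackCertificatesNearFarGlueRLoose`), call a particle NET-BOUND if `A_j(x) < 0` and a
configuration net-bound if all its particles are.

* `sep_of_netBound` (§1): a net-bound finite injective configuration is `3/10`-SEPARATED — at a
  closest pair, distance `d < 3/10`, the shell sum `Σ_k |x_j − x_k|⁻⁶ ≤ 250·d⁻⁶`
  (`sum_inv_pow_six_le`) gives `A_j ≥ ½V(d) − (125/3)d⁻⁶ = d⁻¹²/24 − (1/12 + 125/3)·d⁻⁶ > 0`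
  because `d⁻⁶ > (10/3)⁶ > 1002`.
* `exists_netBound_core` (§2): every finite injective `x` has a net-bound sub-configuration
  `x ∘ f`, `f : Fin K ↪ Fin N`, with `[𝓔(x ∘ f) − K·e*] + (711/1000)·(N − K) ≤ 𝓔(x) − N·e*`:
  strip the particles with `A_j ≥ 0` (`strip_round`: restriction identity, `loose_sum_le` and the
  tree's certified `e* ≤ −0.711`), and recurse (strong induction on `N`).
* §3: two transfer lemmas for sub-configurations along an arbitrary embedding — the fibre count
  with separation assumed only on the counted set (`fibre_count_on`) and the survival of
  `1/20`-goodness when only particles farther than `3/2` are removed (`good_comp_of_good_far`, the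
  converse of the tree's `good_of_good_comp`).

Part 3b (`PhononSlackCertificatesNearFarGlueRLooseReduction`) turns this into the reduction of the
registered residual `stub_tightContactGap` to net-bound (`3/10`-separated) configurations.
All `[folklore]`.
-/

noncomputable section

namespace Summit.AtomisticToContinuum.Crystallization.Theorems.PhononSlackCertificatesNearFarGlueR

open Literature.MathematicalPhysics.StatisticalMechanics
open Literature.Geometry.DiscreteGeometry
open Summit.AtomisticToContinuum.Crystallization.Theses.PhononSlackCertificates
open Summit.AtomisticToContinuum.Crystallization.Theorems.OnePercentFccRung (eStar_le_neg)
open Summit.AtomisticToContinuum.Crystallization.Theorems.CoerciveTwoShellGapSepReduction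
  (dist_lt_of_matched)
open scoped BigOperators

/-! ## §1 Net-bound configurations are `3/10`-separated -/

/-- Lower bound for the half-repulsion functional at any particle of an `r`-separated configuration
in terms of ONE neighbour at distance `d`: `A_j ≥ ½·V(d) − (125/3)·r⁻⁶`. [folklore] -/
theorem looseFun_ge_of_sep {N : ℕ} (x : Fin N → EuclideanSpace ℝ (Fin 3)) {r : ℝ} (hr : 0 < r)
    (hsep : ∀ k l : Fin N, k ≠ l → r ≤ dist (x k) (x l)) {j j₀ : Fin N} (hj : j₀ ≠ j) :
    (1 / 2 : ℝ) * lennardJones (dist (x j) (x j₀)) - (125 / 3 : ℝ) * r⁻¹ ^ 6 ≤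
      ∑ k ∈ Finset.univ.erase j,
        (min (lennardJones (dist (x j) (x k))) 0 + (1 / 2 : ℝ) * max (lennardJones (dist (x j) (x k))) 0) := by
  classical
  rw [Finset.sum_add_distrib, ← Finset.mul_sum]
  have hshell := sum_inv_pow_six_le x hr hsep j
  -- attractive parts: `min(V,0) ≥ −(1/6)|x_j − x_k|⁻⁶`
  have hmin : ∀ k ∈ Finset.univ.erase j,
      -((1 / 6 : ℝ) * (dist (x j) (x k))⁻¹ ^ 6) ≤ min (lennardJones (dist (x j) (x k))) 0 := by
    intro k hk
    have hjk : j ≠ k := (Finset.ne_of_mem_erase hk).symm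
    have hpos : 0 < dist (x j) (x k) := lt_of_lt_of_le hr (hsep j k hjk)
    refine le_min (neg_le_lennardJones_of_le hpos le_rfl) ?_
    have : 0 ≤ (1 / 6 : ℝ) * (dist (x j) (x k))⁻¹ ^ 6 := by positivity
    linarith
  have h1 : -((1 / 6 : ℝ) * ∑ k ∈ Finset.univ.erase j, (dist (x j) (x k))⁻¹ ^ 6) ≤
      ∑ k ∈ Finset.univ.erase j, min (lennardJones (dist (x j) (x k))) 0 := by
    rw [Finset.mul_sum, ← Finset.sum_neg_distrib]
    exact Finset.sum_le_sum hmin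
  -- repulsive parts: keep only the `j₀` term
  have h2 : max (lennardJones (dist (x j) (x j₀))) 0 ≤
      ∑ k ∈ Finset.univ.erase j, max (lennardJones (dist (x j) (x k))) 0 :=
    Finset.single_le_sum (f := fun k => max (lennardJones (dist (x j) (x k))) 0)
      (fun k _ => le_max_right _ _) (Finset.mem_erase.2 ⟨hj, Finset.mem_univ _⟩)
  have h3 : lennardJones (dist (x j) (x j₀)) ≤ max (lennardJones (dist (x j) (x j₀))) 0 :=
    le_max_left _ _
  nlinarith [h1, h2, h3, hshell]

/-- **Net-bound configurations are `3/10`-separated.**  If `A_j(x) < 0` for every particle of the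
injective configuration `x`, then all mutual distances are `≥ 3/10`: at a closest pair `(j, j₀)`,
distance `d < 3/10`, every distance is `≥ d`, so `A_j ≥ ½V(d) − (125/3)d⁻⁶ =
d⁻¹²/24 − (1/12 + 125/3)d⁻⁶ > 0` since `d⁻⁶ > (10/3)⁶ > 1002`. [folklore] -/
theorem sep_of_netBound {N : ℕ} (x : Fin N → EuclideanSpace ℝ (Fin 3)) (hx : Function.Injective x)
    (hnet : ∀ j : Fin N, ∑ k ∈ Finset.univ.erase j,
      (min (lennardJones (dist (x j) (x k))) 0 + (1 / 2 : ℝ) * max (lennardJones (dist (x j) (x k))) 0) < 0) :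
    ∀ i j : Fin N, i ≠ j → (3 / 10 : ℝ) ≤ dist (x i) (x j) := by
  classical
  -- a closest pair
  set Pairs := (Finset.univ : Finset (Fin N × Fin N)).filter fun p => p.1 ≠ p.2 with hPairs
  intro i j hij
  have hne : Pairs.Nonempty := ⟨(i, j), Finset.mem_filter.2 ⟨Finset.mem_univ _, hij⟩⟩
  obtain ⟨p, hp, hmin⟩ := Finset.exists_min_image Pairs (fun p => dist (x p.1) (x p.2)) hne
  have hp12 : p.1 ≠ p.2 := (Finset.mem_filter.1 hp).2
  set d := dist (x p.1) (x p.2) with hd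
  have hdpos : 0 < d := dist_pos.2 fun h => hp12 (hx h)
  have hsep : ∀ k l : Fin N, k ≠ l → d ≤ dist (x k) (x l) := fun k l hkl =>
    hmin (k, l) (Finset.mem_filter.2 ⟨Finset.mem_univ _, hkl⟩)
  by_contra hlt
  push Not at hlt
  have hdlt : d < 3 / 10 := lt_of_le_of_lt (hsep i j hij) hlt
  -- the functional at `p.1`
  have hA := looseFun_ge_of_sep x hdpos hsep (j := p.1) (j₀ := p.2) hp12.symm
  have hneg := hnet p.1
  -- numerics: u = d⁻⁶ > 1002
  set u : ℝ := d⁻¹ ^ 6 with hu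
  have hinv : 10 / 3 < d⁻¹ := by
    rw [lt_inv_comm₀ (by norm_num) hdpos]
    norm_num
    exact hdlt
  have hu_gt : (10 / 3 : ℝ) ^ 6 < u := pow_lt_pow_left₀ hinv (by norm_num) (by norm_num)
  have hu1002 : 1002 < u := lt_trans (by norm_num) hu_gt
  have hV : lennardJones d = (1 / 12) * u ^ 2 - (1 / 6) * u := by
    rw [hu]; unfold lennardJones; ring
  rw [hV] at hA
  have hupos : 0 < u := by positivity
  have key : 0 < u * (u - 1002) := mul_pos hupos (by linarith)
  nlinarith [hA, hneg, key]

/-! ## §2 Loose exhaustion -/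

/-- One stripping round: removing the set `W` of particles with `A_j ≥ 0` costs nothing —
`[𝓔(x|Wᶜ) − #Wᶜ·e*] + (711/1000)·#W ≤ 𝓔(x) − N·e*`. [folklore] -/
theorem strip_round {N K : ℕ} (x : Fin N → EuclideanSpace ℝ (Fin 3)) (W : Finset (Fin N))
    (f : Fin K ↪ Fin N) (hmap : Finset.univ.map f = Wᶜ)
    (hW : ∀ j ∈ W, (0 : ℝ) ≤ ∑ k ∈ Finset.univ.erase j,
      (min (lennardJones (dist (x j) (x k))) 0 + (1 / 2 : ℝ) * max (lennardJones (dist (x j) (x k))) 0)) :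
    interactionEnergy lennardJones (x ∘ f) -
        (K : ℝ) * (⨅ Q : PeriodicConfiguration 3, Q.energyPerParticle lennardJones) +
        (711 / 1000 : ℝ) * (W.card : ℝ) ≤
      interactionEnergy lennardJones x -
        (N : ℝ) * (⨅ Q : PeriodicConfiguration 3, Q.energyPerParticle lennardJones) := by
  have hid := interactionEnergy_eq_restrict_add x W f hmap
  have hle := loose_sum_le x W
  have hsum : ∑ j ∈ W, (0 : ℝ) ≤ ∑ j ∈ W, ∑ k ∈ Finset.univ.erase j,
      (min (lennardJones (dist (x j) (x k))) 0 +
        (1 / 2 : ℝ) * max (lennardJones (dist (x j) (x k))) 0) := Finset.sum_le_sum hW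
  rw [Finset.sum_const, smul_zero] at hsum
  have hK : (K : ℝ) = (N : ℝ) - (W.card : ℝ) := by
    have h1 : (Finset.univ.map f).card = Wᶜ.card := by rw [hmap]
    rw [Finset.card_map, Finset.card_univ, Fintype.card_fin, Finset.card_compl,
      Fintype.card_fin] at h1
    rw [h1, Nat.cast_sub (by simpa using W.card_le_univ)]
  have hstar : (⨅ Q : PeriodicConfiguration 3, Q.energyPerParticle lennardJones) ≤ -(711 / 1000 : ℝ) :=
    eStar_le_neg
  have hW0 : 0 ≤ (W.card : ℝ) := Nat.cast_nonneg _
  rw [hK]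
  nlinarith [hid, hle, hsum, mul_le_mul_of_nonneg_left hstar hW0]

/-- **Loose exhaustion.**  Every finite injective configuration `x` has a NET-BOUND
sub-configuration `x ∘ f` (`f : Fin K ↪ Fin N`) with
`[𝓔(x ∘ f) − K·e*] + (711/1000)·(N − K) ≤ 𝓔(x) − N·e*` (strong induction on `N`, one stripping
round at a time). [folklore] -/
theorem exists_netBound_core :
    ∀ (N : ℕ) (x : Fin N → EuclideanSpace ℝ (Fin 3)), Function.Injective x →
      ∃ (K : ℕ) (f : Fin K ↪ Fin N),
        (∀ k : Fin K, ∑ l ∈ Finset.univ.erase k,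
          (min (lennardJones (dist (x (f k)) (x (f l)))) 0 +
            (1 / 2 : ℝ) * max (lennardJones (dist (x (f k)) (x (f l)))) 0) < 0) ∧
        interactionEnergy lennardJones (x ∘ f) -
            (K : ℝ) * (⨅ Q : PeriodicConfiguration 3, Q.energyPerParticle lennardJones) +
            (711 / 1000 : ℝ) * ((N : ℝ) - K) ≤
          interactionEnergy lennardJones x -
            (N : ℝ) * (⨅ Q : PeriodicConfiguration 3, Q.energyPerParticle lennardJones) := by
  classical
  intro N
  induction N using Nat.strong_induction_on with
  | _ N ih =>
    intro x hx
    set W := Finset.univ.filter fun j : Fin N => (0 : ℝ) ≤ ∑ k ∈ Finset.univ.erase j,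
      (min (lennardJones (dist (x j) (x k))) 0 +
        (1 / 2 : ℝ) * max (lennardJones (dist (x j) (x k))) 0) with hW
    by_cases hW0 : W = ∅
    · -- already net-bound: keep everything
      refine ⟨N, Function.Embedding.refl _, fun k => ?_, ?_⟩
      · have hk : k ∉ W := by rw [hW0]; exact Finset.notMem_empty _
        have hlt' : ∑ l ∈ Finset.univ.erase k,
            (min (lennardJones (dist (x k) (x l))) 0 +
              (1 / 2 : ℝ) * max (lennardJones (dist (x k) (x l))) 0) < 0 :=
          not_le.1 fun h => hk (Finset.mem_filter.2 ⟨Finset.mem_univ _, h⟩)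
        simpa using hlt'
      · have hE0 : interactionEnergy lennardJones (x ∘ ⇑(Function.Embedding.refl (Fin N))) =
            interactionEnergy lennardJones x := rfl
        rw [hE0]
        simp
    · -- strip W and recurse
      set f₀ := (Wᶜ).orderEmbOfFin rfl with hf₀
      have hmap : Finset.univ.map f₀.toEmbedding = Wᶜ := Finset.map_orderEmbOfFin_univ Wᶜ rfl
      have hWpos : 0 < W.card := Finset.card_pos.2 (Finset.nonempty_iff_ne_empty.2 hW0)
      have hlt : Wᶜ.card < N := by
        rw [Finset.card_compl, Fintype.card_fin]
        have : W.card ≤ N := by simpa using W.card_le_univ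
        omega
      obtain ⟨K, f₁, hnet, hE⟩ := ih _ hlt (x ∘ f₀.toEmbedding) (hx.comp f₀.toEmbedding.injective)
      refine ⟨K, f₁.trans f₀.toEmbedding, fun k => by simpa using hnet k, ?_⟩
      have hround := strip_round x W f₀.toEmbedding hmap
        (fun j hj => (Finset.mem_filter.1 hj).2)
      have hK : ((Wᶜ.card : ℕ) : ℝ) = (N : ℝ) - (W.card : ℝ) := by
        rw [Finset.card_compl, Fintype.card_fin, Nat.cast_sub (by simpa using W.card_le_univ)]
      rw [hK] at hE hround
      have hcomp : interactionEnergy lennardJones (x ∘ ⇑(f₁.trans f₀.toEmbedding)) =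
          interactionEnergy lennardJones ((x ∘ f₀.toEmbedding) ∘ f₁) := rfl
      rw [hcomp]
      linarith [hround, hE]

/-- **Registered sub-goal `stub_looseExhaustion` of the crux item** (skeleton `Lines/Sketch.lean`,
c3): loose exhaustion with the separation of the core made explicit — every finite injective
configuration has a net-bound, `3/10`-separated sub-configuration reached at no cost against `N·e*`.
[folklore] -/
theorem stub_looseExhaustion :
    ∀ (N : ℕ) (x : Fin N → EuclideanSpace ℝ (Fin 3)), Function.Injective x →
      ∃ (K : ℕ) (f : Fin K ↪ Fin N),
        (∀ k : Fin K, ∑ l ∈ Finset.univ.erase k,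
          (min (lennardJones (dist (x (f k)) (x (f l)))) 0 +
            (1 / 2 : ℝ) * max (lennardJones (dist (x (f k)) (x (f l)))) 0) < 0) ∧
        (∀ k l : Fin K, k ≠ l → (3 / 10 : ℝ) ≤ dist (x (f k)) (x (f l))) ∧
        interactionEnergy lennardJones (x ∘ f) -
            (K : ℝ) * (⨅ Q : PeriodicConfiguration 3, Q.energyPerParticle lennardJones) +
            (711 / 1000 : ℝ) * ((N : ℝ) - K) ≤
          interactionEnergy lennardJones x -
            (N : ℝ) * (⨅ Q : PeriodicConfiguration 3, Q.energyPerParticle lennardJones) := by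
  intro N x hx
  obtain ⟨K, f, hnet, hE⟩ := exists_netBound_core N x hx
  exact ⟨K, f, hnet, sep_of_netBound (x ∘ f) (hx.comp f.injective) hnet, hE⟩

/-! ## §3 Transfer lemmas along an embedding -/

/-- **Fibre count with separation only on `S`**: if the particles of `S` are pairwise
`δ`-separated and each lies within `R` of some particle of `T`, then `#S ≤ (2R/δ+1)³·#T`.
[folklore] -/
theorem fibre_count_on {δ R : ℝ} (hδ : 0 < δ) (hR : 0 ≤ R) {N : ℕ} (x : Fin N → EuclideanSpace ℝ (Fin 3))
    (S T : Finset (Fin N)) (hsep : ∀ i ∈ S, ∀ j ∈ S, i ≠ j → δ ≤ dist (x i) (x j))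
    (hST : ∀ j ∈ S, ∃ k ∈ T, dist (x j) (x k) ≤ R) :
    (S.card : ℝ) ≤ (2 * R / δ + 1) ^ 3 * (T.card : ℝ) := by
  classical
  set F : Fin N → Finset (Fin N) := fun k => S.filter fun j => dist (x j) (x k) ≤ R with hF
  have hcover : S ⊆ T.biUnion F := by
    intro j hj
    obtain ⟨k, hk, hd⟩ := hST j hj
    exact Finset.mem_biUnion.2 ⟨k, hk, Finset.mem_filter.2 ⟨hj, hd⟩⟩
  have hfibre : ∀ k ∈ T, ((F k).card : ℝ) ≤ (2 * R / δ + 1) ^ 3 := by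
    intro k _
    have hinj : Set.InjOn x (F k) := fun a ha b hb hab => by
      by_contra hne
      have := hsep a (Finset.mem_filter.1 ha).1 b (Finset.mem_filter.1 hb).1 hne
      rw [hab, dist_self] at this
      exact absurd this (not_le.2 hδ)
    rw [← Finset.card_image_of_injOn hinj]
    have h := card_le_of_separated_of_dist_le ((F k).image x) (x k) hδ hR ?_ ?_
    · rwa [finrank_euclideanSpace_fin] at h
    · intro c hc
      obtain ⟨j, hj, rfl⟩ := Finset.mem_image.1 hc
      exact (Finset.mem_filter.1 hj).2
    · intro c hc c' hc' hne
      obtain ⟨a, ha, rfl⟩ := Finset.mem_image.1 hc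
      obtain ⟨b, hb, rfl⟩ := Finset.mem_image.1 hc'
      exact hsep a (Finset.mem_filter.1 ha).1 b (Finset.mem_filter.1 hb).1 fun h => hne (h ▸ rfl)
  have h1 : (S.card : ℝ) ≤ ((T.biUnion F).card : ℝ) := by exact_mod_cast Finset.card_le_card hcover
  have h2 : ((T.biUnion F).card : ℝ) ≤ ∑ k ∈ T, ((F k).card : ℝ) := by
    exact_mod_cast Finset.card_biUnion_le
  have h3 : ∑ k ∈ T, ((F k).card : ℝ) ≤ ∑ k ∈ T, (2 * R / δ + 1) ^ 3 := Finset.sum_le_sum hfibre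
  rw [Finset.sum_const, nsmul_eq_mul] at h3
  linarith

/-- **Goodness survives the removal of far particles**: if `f k` is `1/20`-good in `x` and every
particle of `x` outside the range of `f` is farther than `3/2` from `x (f k)`, then `k` is good in
`x ∘ f` (every matched particle lies within `(1/20 + √2)·a < 3/2`, hence in the range of `f`; pull
the assignment back along `f`). [folklore] -/
theorem good_comp_of_good_far {N K : ℕ} (x : Fin N → EuclideanSpace ℝ (Fin 3)) (f : Fin K ↪ Fin N)
    (k : Fin K) (hfar : ∀ j : Fin N, j ∉ Set.range f → 3 / 2 < dist (x j) (x (f k)))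
    (h : IsTwoShellGood (1 / 20) (47 / 50) 1 x (f k)) :
    IsTwoShellGood (1 / 20) (47 / 50) 1 (x ∘ f) k := by
  classical
  haveI : Nonempty (Fin K) := ⟨k⟩
  obtain ⟨a, ha₁, ha₂, A, P, g, hP, hg, hinj, hsurj⟩ := h
  -- every matched particle is in the range of f
  have hmem : ∀ v ∈ P, g v ∈ Set.range f := by
    intro v hv
    by_contra hnot
    have hlt := dist_lt_of_matched ha₁ ha₂ A hP hv (hg v hv).2
    exact absurd (hfar _ hnot) (not_lt.2 hlt.le)
  set g' : EuclideanSpace ℝ (Fin 3) → Fin K := fun v => Function.invFun f (g v) with hg'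
  have key : ∀ v ∈ P, f (g' v) = g v := fun v hv => Function.invFun_eq (hmem v hv)
  refine ⟨a, ha₁, ha₂, A, P, g', hP, fun v hv => ⟨fun h => (hg v hv).1 ?_, ?_⟩,
    fun v hv w hw hvw => hinj hv hw ?_, fun j' hj' hd => ?_⟩
  · rw [← key v hv, h]
  · show dist (x (f (g' v))) (x (f k) + a • A v) ≤ 1 / 20 * a
    rw [key v hv]
    exact (hg v hv).2
  · rw [← key v hv, ← key w hw, hvw]
  · obtain ⟨v, hv, hgv⟩ := hsurj (f j') (fun h => hj' (f.injective h)) hd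
    exact ⟨v, hv, f.injective (by rw [key v hv, hgv])⟩

end Summit.AtomisticToContinuum.Crystallization.Theorems.PhononSlackCertificatesNearFarGlueR

end
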